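import Literature.AlgebraicGeometry.Resolution.ProjectiveModelsJoin
import Literature.AlgebraicGeometry.Resolution.ProjectiveModels
import HarnessLib

/-!
# Crux `PatchingRel` (stmt-ResolutionOfSingularities-0642), line `sandwiched-gluing` (v3 cut,
# quasi-projective branch), stub `stub_projTwoModelPatching_of_projRegLeification`

**RegLe-ification of one morphism of projective models implies two-model patching of projective
models.** The tree theorem `resolutionInChar_of_twoModelPatching_of_relLU`
(`Literature.AlgebraicGeometry.Resolution.ZariskiPatchingAllDimensions`) reduces Zariski patching
to the two-model patching statement for PROJECTIVE models `ProjModel k K` of a function field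
`K/k` (`Literature.AlgebraicGeometry.Resolution.ProjectiveModels`): any two projective models
`M₁`, `M₂` are dominated by a third one `N` through morphisms `φᵢ : N → Mᵢ` with
`φᵢ⁻¹(Reg Mᵢ) ⊆ Reg N` (`ProjModel.Hom.RegLe`). The quasi-projective branch of the v3 cut of the
line `sandwiched-gluing` produces the minimal content of this — the RegLe-IFICATION of ONE morphism
of projective models `φ : M → Y`: some `ψ : M' → M` with `ψ⁻¹(Reg M) ⊆ Reg M'` and
`(φψ)⁻¹(Reg Y) ⊆ Reg M'`. This file is the pure-logic step from the latter to the former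
(Piltant 2013, proof of Prop. 5.1, Step 2; the `ProperModel` analogue is
`SandwichedGluing.twoModelPatching_of_regLeification`,
`Literature.AlgebraicGeometry.Resolution.ProperModelsPatchingGluing`):

* `projTwoModelPatching_of_projRegLeification` — join the two models (`ProjModel.exists_join`,
  Zariski–Samuel II, Ch. VI §17: `N₀ → M₁`, `N₀ → M₂`), RegLe-ify `N₀ → M₂` to get
  `ψ₂ : X₂' → N₀`, then RegLe-ify the composite `X₂' → N₀ → M₁` to get `ψ : N → X₂'`; the two
  composites `N → M₁`, `N → M₂` do not destroy regularity (`ProjModel.Hom.RegLe.comp`);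
* `stub_projTwoModelPatching_of_projRegLeification` — the registered universe-`0` stub QP2.

## References

* O. Piltant, *An axiomatic version of Zariski's patching theorem*, RACSAM 107 (2013) 91–121,
  proof of Prop. 5.1, Step 2. [Piltant2013]
* O. Zariski, P. Samuel, *Commutative Algebra* II, Ch. VI §17 (joins of models).
  [ZariskiSamuel1960]
-/

-- `Summit.<Summit>.<Sub>.Theorems` with `Sub = Summit` (single-conjunct summit, D-0017): the
-- duplicated namespace component is the tree layout.
set_option linter.dupNamespace false

noncomputable section

namespace Summit.ResolutionOfSingularities.ResolutionOfSingularities.Theorems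

open CategoryTheory AlgebraicGeometry
open Literature.AlgebraicGeometry.Resolution

universe u

/-- **RegLe-ification of one morphism of projective models implies two-model patching of
projective models** (Piltant 2013, proof of Prop. 5.1, Step 2, for `P = P_reg`). If for every
morphism of projective models `φ : M → Y` of `K/k` there is a morphism of models `ψ : M' → M` with
`ψ⁻¹(Reg M) ⊆ Reg M'` and `(φψ)⁻¹(Reg Y) ⊆ Reg M'`, then any two projective models `M₁`, `M₂` of
`K/k` are dominated by a projective model `N` through morphisms `φᵢ : N → Mᵢ` with
`φᵢ⁻¹(Reg Mᵢ) ⊆ Reg N`: RegLe-ify the second projection `N₀ → M₂` of the join `N₀` of `M₁` and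
`M₂` (`ProjModel.exists_join`), then the composite `X₂' → N₀ → M₁`, and compose
(`ProjModel.Hom.RegLe.comp`). [cite: Piltant2013, Prop. 5.1 (proof, Step 2)] -/
theorem projTwoModelPatching_of_projRegLeification {k K : Type u} [Field k] [Field K]
    [Algebra k K]
    (h : ∀ (M Y : ProjModel k K) (φ : M.Hom Y),
      ∃ (M' : ProjModel k K) (ψ : M'.Hom M), ψ.RegLe ∧ (ψ.comp φ).RegLe)
    (M₁ M₂ : ProjModel k K) :
    ∃ (N : ProjModel k K) (φ₁ : N.Hom M₁) (φ₂ : N.Hom M₂), φ₁.RegLe ∧ φ₂.RegLe := by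
  obtain ⟨N₀, ⟨j₁⟩, ⟨j₂⟩⟩ := ProjModel.exists_join M₁ M₂
  obtain ⟨X₂', ψ₂, -, hA⟩ := h N₀ M₂ j₂
  obtain ⟨N, ψ, hψ, hB⟩ := h X₂' M₁ (ψ₂.comp j₁)
  exact ⟨N, ψ.comp (ψ₂.comp j₁), ψ.comp (ψ₂.comp j₂), hB, hψ.comp hA⟩

/-- **Registered stub QP2 of line `sandwiched-gluing` (v3 cut, quasi-projective branch)** (crux
stmt-ResolutionOfSingularities-0642, universe `0`): RegLe-ification of one morphism of projective
models of `K/k` ⇒ two-model patching of projective models of `K/k` (join the two models,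
RegLe-ify twice, compose; `projTwoModelPatching_of_projRegLeification`).
[cite: Piltant2013, Prop. 5.1 (proof, Step 2)] -/
theorem stub_projTwoModelPatching_of_projRegLeification : ∀ (k : Type) [Field k] (K : Type) [Field K] [Algebra k K], (∀ (M Y : Literature.AlgebraicGeometry.Resolution.ProjModel k K) (φ : M.Hom Y), ∃ (M1 : Literature.AlgebraicGeometry.Resolution.ProjModel k K) (ψ : M1.Hom M), ψ.RegLe ∧ (ψ.comp φ).RegLe) → ∀ M₁ M₂ : Literature.AlgebraicGeometry.Resolution.ProjModel k K, ∃ (N : Literature.AlgebraicGeometry.Resolution.ProjModel k K) (φ₁ : N.Hom M₁) (φ₂ : N.Hom M₂), φ₁.RegLe ∧ φ₂.RegLe :=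
  fun _ _ _ _ _ h M₁ M₂ => projTwoModelPatching_of_projRegLeification h M₁ M₂

end Summit.ResolutionOfSingularities.ResolutionOfSingularities.Theorems

end
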